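import Mathlib
import HarnessLib

/-!
# Route `UnthreadedDoor`, crux `PoloidalLiouville` (stmt-NavierStokesRegularity-1222), wall W1 — crux idea
# «flux-starved-dipoles» (ns-idea-15, `Cruxes/PoloidalLiouville/FluxStarvedDipoleSketch.lean`):
# TOOLS for the ancient endgame of K1′ (`DipoleNeverAncient`) by a classical comparison argument

Card §Proof step 5′ closes K1′ through a distributional subsolution (semiconvexity across the kinks of `‖A‖`, removal of the
polar line in `ℝ⁵`, Moser's parabolic mean-value inequality).  The companion file `…AncientEndgame` replaces that route by an
elementary CLASSICAL comparison; this file holds its tools: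

* the one-sided first-order condition at a right-endpoint maximum (`deriv_nonneg_of_isMaxOn_right`; the second-order
  condition `deriv_deriv_nonpos_of_isLocalMax` is `Literature.Analysis.PDE.ABP.deriv_deriv_nonpos_of_isLocalMax`);
* the comparison function `H(τ,r) = K/(r² + 2τ) + ε/r³`, its derivatives, and the STRICT supersolution identity
  `∂τH − (H″ + (4/r)H′) = 16Kτ/(r² + 2τ)³ > 0` for the radial heat operator of `ℝ⁵` (`superH_strict`);
* the POINTWISE SUBSOLUTION inequality: wherever the amplitude identity `⟪A″ + (2/r)A′ − (2/r²)A − ∂ₜA, A⟫ = 0` holds, the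
  formal derivatives of `u = ‖A‖²/r²` satisfy `∂ₜu ≤ u″ + (4/r)u′` with defect `(2/r²)‖A′ − A/r‖²` (`subsolution_pointwise`);
* the derivative formulas for `u = ‖A‖²/r²` in `t` and `r` (first and second order).

HONEST LABEL: dipole (`l = 1`) stratum of the LINEAR kinematic shadow of W1 (critic V28: information-grade, W1 movement 0);
`PoloidalLiouville` (1222), its wall `stub_scalarLiouville` and the summit stay OPEN; NO Navier–Stokes regularity statement is
proved.  `--supports stmt-NavierStokesRegularity-1222` (helper).  [folklore]
-/

noncomputable section

-- the summit and its single sub-problem share the name (CONVENTIONS §1)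
set_option linter.dupNamespace false

open Set Filter Topology InnerProductSpace
open scoped RealInnerProductSpace

namespace Summit.NavierStokesRegularity.NavierStokesRegularity.Theorems.PoloidalLiouville.FluxStarvedDipole

/-! ### One-variable calculus: necessary conditions at a maximum -/

/-- One-sided first-order condition: if `f ≤ f(b)` on `[a,b]` (`a < b`) and `f` is differentiable at `b`, then `f′(b) ≥ 0`.
[folklore] -/
theorem deriv_nonneg_of_isMaxOn_right {f : ℝ → ℝ} {a b f' : ℝ} (hab : a < b) (hmax : ∀ t ∈ Icc a b, f t ≤ f b)
    (hf : HasDerivAt f f' b) : 0 ≤ f' := by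
  have ht : Tendsto (slope f b) (𝓝[<] b) (𝓝 f') :=
    hf.tendsto_slope.mono_left (nhdsWithin_mono _ fun x hx => ne_of_lt hx)
  refine ge_of_tendsto ht ?_
  filter_upwards [Ioo_mem_nhdsLT hab] with t ht'
  rw [slope_def_field]
  exact div_nonneg_of_nonpos (by linarith [hmax t ⟨ht'.1.le, ht'.2.le⟩]) (by linarith [ht'.2])

/-! ### The strict supersolution `H(τ,r) = K/(r² + 2τ) + ε/r³` of `∂τ − ∂ᵣ² − (4/r)∂ᵣ` -/

/-- `∂ᵣH = −2Kr/(r²+2τ)² − 3ε/r⁴` for `H = K/(r²+2τ) + ε/r³`. [folklore] -/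
theorem hasDerivAt_superH_r (K ε : ℝ) {τ r : ℝ} (hτ : 0 < τ) (hr : r ≠ 0) :
    HasDerivAt (fun ρ => (K / (ρ ^ 2 + 2 * τ) + ε / ρ ^ 3))
      ((-(2 * K * r) / (r ^ 2 + 2 * τ) ^ 2 - 3 * ε / r ^ 4)) r := by
  have hρ : r ^ 2 + 2 * τ ≠ 0 := by positivity
  have h1 : HasDerivAt (fun ρ : ℝ => ρ ^ 2 + 2 * τ) (2 * r) r := by
    simpa using ((hasDerivAt_pow 2 r).add_const (2 * τ))
  have h2 : HasDerivAt (fun ρ : ℝ => K / (ρ ^ 2 + 2 * τ)) (-(K * (2 * r)) / (r ^ 2 + 2 * τ) ^ 2) r :=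
    (hasDerivAt_const r K).div h1 hρ |>.congr_deriv (by ring)
  have h3 : HasDerivAt (fun ρ : ℝ => ε / ρ ^ 3) (-(ε * (3 * r ^ 2)) / (r ^ 3) ^ 2) r := by
    have := (hasDerivAt_const r ε).div (hasDerivAt_pow 3 r) (pow_ne_zero 3 hr)
    refine this.congr_deriv ?_
    simp
  refine (h2.add h3).congr_deriv ?_
  field_simp
  ring

/-- `∂ᵣ²H = −2K/(r²+2τ)² + 8Kr²/(r²+2τ)³ + 12ε/r⁵` (derivative of `∂ᵣH`). [folklore] -/
theorem hasDerivAt_superH1_r (K ε : ℝ) {τ r : ℝ} (hτ : 0 < τ) (hr : r ≠ 0) :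
    HasDerivAt (fun ρ => (-(2 * K * ρ) / (ρ ^ 2 + 2 * τ) ^ 2 - 3 * ε / ρ ^ 4))
      ((-(2 * K) / (r ^ 2 + 2 * τ) ^ 2 + 8 * K * r ^ 2 / (r ^ 2 + 2 * τ) ^ 3 + 12 * ε / r ^ 5)) r := by
  have hρ : r ^ 2 + 2 * τ ≠ 0 := by positivity
  have h1 : HasDerivAt (fun ρ : ℝ => (ρ ^ 2 + 2 * τ) ^ 2) (2 * (r ^ 2 + 2 * τ) * (2 * r)) r := by
    have := ((hasDerivAt_pow 2 r).add_const (2 * τ)).pow 2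
    refine this.congr_deriv ?_
    simp
  have h2 : HasDerivAt (fun ρ : ℝ => -(2 * K * ρ) / (ρ ^ 2 + 2 * τ) ^ 2)
      ((-(2 * K) * (r ^ 2 + 2 * τ) ^ 2 - -(2 * K * r) * (2 * (r ^ 2 + 2 * τ) * (2 * r)))
        / ((r ^ 2 + 2 * τ) ^ 2) ^ 2) r := by
    have hn : HasDerivAt (fun ρ : ℝ => -(2 * K * ρ)) (-(2 * K)) r := by
      have h := (hasDerivAt_id r).const_mul (-(2 * K))
      have hfun : (fun ρ : ℝ => -(2 * K * ρ)) = fun y => -(2 * K) * id y := by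
        funext y; simp only [id]; ring
      rw [hfun]
      exact h.congr_deriv (by simp)
    exact hn.div h1 (pow_ne_zero 2 hρ)
  have h3 : HasDerivAt (fun ρ : ℝ => 3 * ε / ρ ^ 4) (-(3 * ε * (4 * r ^ 3)) / (r ^ 4) ^ 2) r := by
    have := (hasDerivAt_const r (3 * ε)).div (hasDerivAt_pow 4 r) (pow_ne_zero 4 hr)
    refine this.congr_deriv ?_
    simp
  refine (h2.sub h3).congr_deriv ?_
  field_simp
  ring

/-- `∂τH = −2K/(r²+2τ)²`. [folklore] -/
theorem hasDerivAt_superH_τ (K ε : ℝ) {τ r : ℝ} (hτ : 0 < τ) :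
    HasDerivAt (fun σ => (K / (r ^ 2 + 2 * σ) + ε / r ^ 3)) ((-(2 * K) / (r ^ 2 + 2 * τ) ^ 2)) τ := by
  have hρ : r ^ 2 + 2 * τ ≠ 0 := by positivity
  have h1 : HasDerivAt (fun σ : ℝ => r ^ 2 + 2 * σ) 2 τ := by
    simpa using ((hasDerivAt_id τ).const_mul 2).const_add (r ^ 2)
  have h2 : HasDerivAt (fun σ : ℝ => K / (r ^ 2 + 2 * σ)) (-(K * 2) / (r ^ 2 + 2 * τ) ^ 2) τ :=
    (hasDerivAt_const τ K).div h1 hρ |>.congr_deriv (by ring)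
  refine (h2.add_const (ε / r ^ 3)).congr_deriv ?_
  ring

/-- STRICT SUPERSOLUTION: `∂τH − (H″ + (4/r)H′) = 16Kτ/(r² + 2τ)³ > 0`. [folklore] -/
theorem superH_strict {K ε τ r : ℝ} (hK : 0 < K) (hτ : 0 < τ) (hr : 0 < r) :
    (-(2 * K) / (r ^ 2 + 2 * τ) ^ 2 + 8 * K * r ^ 2 / (r ^ 2 + 2 * τ) ^ 3 + 12 * ε / r ^ 5)
        + 4 / r * (-(2 * K * r) / (r ^ 2 + 2 * τ) ^ 2 - 3 * ε / r ^ 4)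
      < (-(2 * K) / (r ^ 2 + 2 * τ) ^ 2) := by
  have hρ : 0 < r ^ 2 + 2 * τ := by positivity
  have key : (-(2 * K) / (r ^ 2 + 2 * τ) ^ 2)
        - ((-(2 * K) / (r ^ 2 + 2 * τ) ^ 2 + 8 * K * r ^ 2 / (r ^ 2 + 2 * τ) ^ 3 + 12 * ε / r ^ 5)
            + 4 / r * (-(2 * K * r) / (r ^ 2 + 2 * τ) ^ 2 - 3 * ε / r ^ 4))
      = 16 * K * τ / (r ^ 2 + 2 * τ) ^ 3 := by
    field_simp
    ring
  have hpos : 0 < 16 * K * τ / (r ^ 2 + 2 * τ) ^ 3 := by positivity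
  linarith

/-! ### The pointwise subsolution inequality behind `u = ‖A‖²/r²` -/

/-- POINTWISE SUBSOLUTION.  For vectors `a, a₁, a₂, ȧ` (values of `A, A′, A″, ∂ₜA` at a point) and `r > 0` satisfying the
amplitude identity `⟪a₂ + (2/r)a₁ − (2/r²)a − ȧ, a⟫ = 0`, the formal derivatives of `u = ‖A‖²/r²` —
`uₜ = 2⟪ȧ,a⟫/r²`, `uᵣ = 2⟪a₁,a⟫/r² − 2‖a‖²/r³`, `uᵣᵣ = (2⟪a₂,a⟫ + 2‖a₁‖²)/r² − 8⟪a₁,a⟫/r³ + 6‖a‖²/r⁴` — satisfy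
`uₜ ≤ uᵣᵣ + (4/r)uᵣ`, the defect being `(2/r²)‖a₁ − a/r‖²`. [folklore] -/
theorem subsolution_pointwise {F : Type*} [NormedAddCommGroup F] [InnerProductSpace ℝ F]
    (a a₁ a₂ adot : F) {r : ℝ} (hr : 0 < r)
    (hid : ⟪a₂ + (2 / r) • a₁ - (2 / r ^ 2) • a - adot, a⟫ = 0) :
    2 * ⟪adot, a⟫ / r ^ 2 ≤
      ((2 * ⟪a₂, a⟫ + 2 * ‖a₁‖ ^ 2) / r ^ 2 - 8 * ⟪a₁, a⟫ / r ^ 3 + 6 * ‖a‖ ^ 2 / r ^ 4)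
        + 4 / r * (2 * ⟪a₁, a⟫ / r ^ 2 - 2 * ‖a‖ ^ 2 / r ^ 3) := by
  have hsq : 0 ≤ ‖a₁ - r⁻¹ • a‖ ^ 2 := by positivity
  rw [norm_sub_sq_real, real_inner_smul_right, norm_smul, Real.norm_eq_abs, abs_of_pos (inv_pos.mpr hr)]
    at hsq
  rw [inner_sub_left, inner_sub_left, inner_add_left, real_inner_smul_left, real_inner_smul_left,
    real_inner_self_eq_norm_sq] at hid
  have hr2 : 0 < r ^ 2 := by positivity
  rw [mul_pow, inv_pow] at hsq
  -- clear denominators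
  rw [← sub_nonneg]
  have key : ((2 * ⟪a₂, a⟫ + 2 * ‖a₁‖ ^ 2) / r ^ 2 - 8 * ⟪a₁, a⟫ / r ^ 3 + 6 * ‖a‖ ^ 2 / r ^ 4)
        + 4 / r * (2 * ⟪a₁, a⟫ / r ^ 2 - 2 * ‖a‖ ^ 2 / r ^ 3) - 2 * ⟪adot, a⟫ / r ^ 2
      = 2 / r ^ 2 * (‖a₁‖ ^ 2 - 2 * (r⁻¹ * ⟪a₁, a⟫) + (r ^ 2)⁻¹ * ‖a‖ ^ 2) := by
    have hadot : ⟪adot, a⟫ = ⟪a₂, a⟫ + 2 / r * ⟪a₁, a⟫ - 2 / r ^ 2 * ‖a‖ ^ 2 := by linarith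
    rw [hadot]
    field_simp
    ring
  rw [key]
  exact mul_nonneg (by positivity) hsq

/-! ### Derivatives of `u = ‖A‖²/r²` -/

section Derivs

variable {F : Type*} [NormedAddCommGroup F] [InnerProductSpace ℝ F]

/-- `∂ₜ(‖g(t)‖²/r²) = 2⟪ġ, g⟫/r²`. [folklore] -/
theorem hasDerivAt_normSq_div_const (g : ℝ → F) {g' : F} {t : ℝ} (r : ℝ) (hg : HasDerivAt g g' t) :
    HasDerivAt (fun s => ‖g s‖ ^ 2 / r ^ 2) (2 * ⟪g', g t⟫ / r ^ 2) t := by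
  have h := hg.norm_sq.div_const (r ^ 2)
  refine h.congr_deriv ?_
  rw [real_inner_comm]

/-- `∂ᵣ(‖f‖²/r²) = 2⟪f′, f⟫/r² − 2‖f‖²/r³`. [folklore] -/
theorem hasDerivAt_normSq_div_sq {f : ℝ → F} {f' : F} {r : ℝ} (hf : HasDerivAt f f' r) (hr : r ≠ 0) :
    HasDerivAt (fun ρ => ‖f ρ‖ ^ 2 / ρ ^ 2) (2 * ⟪f', f r⟫ / r ^ 2 - 2 * ‖f r‖ ^ 2 / r ^ 3) r := by
  have h := hf.norm_sq.div (hasDerivAt_pow 2 r) (pow_ne_zero 2 hr)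
  refine h.congr_deriv ?_
  rw [real_inner_comm]
  simp only [Nat.cast_ofNat, Nat.add_one_sub_one, pow_one]
  field_simp

/-- `∂ᵣ(2⟪f′, f⟫/r² − 2‖f‖²/r³) = (2⟪f″, f⟫ + 2‖f′‖²)/r² − 8⟪f′, f⟫/r³ + 6‖f‖²/r⁴`. [folklore] -/
theorem hasDerivAt_normSq_div_sq_deriv {f : ℝ → F} {f₁ f₂ : F} {r : ℝ} (hf : HasDerivAt f f₁ r)
    (hf2 : HasDerivAt (deriv f) f₂ r) (hr : r ≠ 0) :
    HasDerivAt (fun ρ => 2 * ⟪deriv f ρ, f ρ⟫ / ρ ^ 2 - 2 * ‖f ρ‖ ^ 2 / ρ ^ 3)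
      ((2 * ⟪f₂, f r⟫ + 2 * ‖f₁‖ ^ 2) / r ^ 2 - 8 * ⟪f₁, f r⟫ / r ^ 3 + 6 * ‖f r‖ ^ 2 / r ^ 4) r := by
  have hdf : deriv f r = f₁ := hf.deriv
  have hin : HasDerivAt (fun ρ => ⟪deriv f ρ, f ρ⟫) (⟪deriv f r, f₁⟫ + ⟪f₂, f r⟫) r := hf2.inner ℝ hf
  have h1 : HasDerivAt (fun ρ => 2 * ⟪deriv f ρ, f ρ⟫ / ρ ^ 2)
      ((2 * (⟪deriv f r, f₁⟫ + ⟪f₂, f r⟫) * r ^ 2 - 2 * ⟪deriv f r, f r⟫ * (↑(2 : ℕ) * r ^ (2 - 1)))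
        / (r ^ 2) ^ 2) r :=
    (hin.const_mul 2).div (hasDerivAt_pow 2 r) (pow_ne_zero 2 hr)
  have h2 : HasDerivAt (fun ρ => 2 * ‖f ρ‖ ^ 2 / ρ ^ 3)
      ((2 * (2 * ⟪f r, f₁⟫) * r ^ 3 - 2 * ‖f r‖ ^ 2 * (↑(3 : ℕ) * r ^ (3 - 1))) / (r ^ 3) ^ 2) r :=
    (hf.norm_sq.const_mul 2).div (hasDerivAt_pow 3 r) (pow_ne_zero 3 hr)
  refine (h1.sub h2).congr_deriv ?_
  rw [hdf, real_inner_self_eq_norm_sq, real_inner_comm (f r) f₁]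
  simp only [Nat.cast_ofNat, Nat.add_one_sub_one, pow_one]
  field_simp
  ring

end Derivs

end Summit.NavierStokesRegularity.NavierStokesRegularity.Theorems.PoloidalLiouville.FluxStarvedDipole

end
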